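import Literature.Claims.NS.PereiraSilva2025
import Summits.NavierStokesRegularity.NavierStokesRegularity.Theorems.SoloSalvageLucardoOlivaes2026Enstrophy
import Summits.NavierStokesRegularity.NavierStokesRegularity.Theorems.SoloSalvageLucardoOlivaes2026GI
import Summits.NavierStokesRegularity.NavierStokesRegularity.Theorems.SoloRefuteLucardoOlivaes2026
import Literature.Analysis.FluidPDE.NSLerayHopfSereginEnergyProofs
import Summits.NavierStokesRegularity.NavierStokesRegularity.Theorems.SoloRefuteAtarka2026Lemma34
import Mathlib.Analysis.Calculus.LocalExtr.Basic
import Mathlib.Analysis.Calculus.Deriv.MeanValue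
import HarnessLib

/-!
# C149 `PereiraSilva2025` — refuter kit, binder 1 «Combining» (ns-claims-refuter-1 g4)

Companion of `SoloRefutePereiraSilva2025.lean` (skeleton `Literature/Claims/NS/PereiraSilva2025.lean`,
text of record = census pin p001–p006). Kernel object, EVERY `K : Consts`:

* `not_Step32_Combine K : ¬ Step32_Combine K` — p.3 l.143–147 «Combining:
  `dS/dt ≤ (2/3)C_G²C'_G E(0)^{1/6} S + ((1/3)C_G²C'_G E(0)^{1/6} − ν)‖∇ω‖²_{L²}`», binder 1 (`hC`) of
  `claim_of_steps` — the print-EARLIEST consumed binder.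

Witness (amplitude family, no evaluation of the flow at positive times): datum `A • U` (`U` = the tree's
two-blob field with `0 < stretchI U`, `A = M³`), viscosity `ν = (1/3)C_G²C'_G·M·E(U)^{1/6} + 1`, so that
`E(0)^{1/6} = M·E(U)^{1/6}` and the printed coefficient of `‖∇ω‖²` equals `−1 ≤ 0`. Along the Chae/BKM
local solution (`exists_isLocalSolution`; a `SlabSol` on `[0, T/2)`, `slabSol_smul_U`), the Lindgren slab identity
(`lindgren2012_step3_holds`) supplies the derivative of `S` at every interior time, so «Combining» gives
`S' ≤ a S` there (`a = (2/3)C_G²C'_G M E(U)^{1/6}`), whence `t ↦ e^{−at} S(t)` is antitone on `[0, T/2]`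
(mean value theorem, interior hypotheses only); but at `t = 0⁺` the same identity evaluated ON THE DATUM
gives the right-derivative `2(A³σ − νA²P_F) − aA²S(U) > 0` of `e^{−at}S(t)` for `M` large — contradiction.
[cite: PereiraSilva2025, p.3 l.143–147]

WHAT THIS IS NOT: not a claim about NS regularity or blow-up; not a claim about any author beyond the
typed locator.
-/

set_option linter.dupNamespace false

noncomputable section

open Real Set Function MeasureTheory Filter
open scoped ENNReal NNReal ContDiff RealInnerProductSpace Topology

namespace Summit.NavierStokesRegularity.NavierStokesRegularity.Theorems.PereiraSilva2025

open Literature.Analysis.FluidPDE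
open Literature.Claims.NS.PereiraSilva2025
open Literature.Claims.NS.PaiLimsuwan2026 (SlabSol)
open Literature.Claims.NS.Chae2007 (IsDatum IsLocalSolution)
open Literature.Claims.NS.LucardoOlivaes2026 (E3 IsOuroDatum stretchI)
open Literature.Claims.NS.Lindgren2012 (enstrophy stretchPerp stretch dissip stretchPerp_eq)
open Summit.NavierStokesRegularity.NavierStokesRegularity.Theorems.Lindgren2012Salvage
  (lindgren2012_step3_holds integral_stretching_eq_stretch dissip_eq_neg_integral_frobeniusNormSq)
open Summit.NavierStokesRegularity.NavierStokesRegularity.Theorems.LucardoOlivaes2026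
  (isSolutionOn_of_isLocalSolution curl_smul_fun stretchI_smul ens_smul isDatum_smul isOuroDatum_smul
  exists_isLocalSolution)
open Summit.NavierStokesRegularity.NavierStokesRegularity.Theorems.LucardoOlivaes2026GI
  (U U_contDiff U_hasCompactSupport isOuroDatum_U stretchI_U_pos)

namespace Combine

/-! ## Real analysis: a positive right-derivative forces growth -/

/-- If `f` has derivative `D > 0` within `[a,b]` at `a` (`a < b`), then `f a < f t` for some `t ∈ (a,b]`.
[folklore] -/
theorem exists_gt_of_hasDerivWithinAt_pos {f : ℝ → ℝ} {D a b : ℝ} (hab : a < b)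
    (hf : HasDerivWithinAt f D (Icc a b) a) (hD : 0 < D) : ∃ t ∈ Ioc a b, f a < f t := by
  by_contra hcon
  simp only [not_exists, not_and, not_lt] at hcon
  have hmax : IsLocalMaxOn f (Icc a b) a :=
    eventually_nhdsWithin_of_forall fun x hx => by
      rcases eq_or_lt_of_le hx.1 with h | h
      · rw [h]
      · exact hcon x ⟨h, hx.2⟩
  have hy : b - a ∈ posTangentConeAt (Icc a b) a :=
    mem_posTangentConeAt_of_segment_subset (by rw [add_sub_cancel]; exact (segment_eq_Icc hab.le).le)
  have key : (b - a) * D ≤ 0 := by simpa using hmax.hasFDerivWithinAt_nonpos hf.hasFDerivWithinAt hy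
  nlinarith

/-! ## The enstrophy along a regular local solution: derivative at `0⁺` on the datum, interior
derivatives, continuity -/

/-- The Lindgren slab identity on `[0, T/2]` along a Chae/BKM local solution. [folklore] -/
theorem hasDerivWithinAt_enstrophy {ν T : ℝ} (hν : 0 < ν) (hT : 0 < T) {v₀ : E3 → E3}
    {u : ℝ → E3 → E3} {p : ℝ → E3 → ℝ} (h : IsLocalSolution ν T v₀ u p) {t : ℝ}
    (ht : t ∈ Icc 0 (T / 2)) :
    HasDerivWithinAt (fun s => enstrophy (u s)) (2 * (stretchPerp (u t) + ν * dissip (u t)))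
      (Icc 0 (T / 2)) t :=
  lindgren2012_step3_holds ν (T / 2) u p hν (by linarith)
    (isSolutionOn_of_isLocalSolution h (by linarith) (by linarith)) t ht

/-- At `t = 0`, within `[0, T/2]`: `dS/dt = 2(∫ω·(∇u)ω − ν∫|∇ω|²_F)` evaluated ON THE DATUM. [folklore] -/
theorem hasDerivWithinAt_enstrophy_zero {ν T : ℝ} (hν : 0 < ν) (hT : 0 < T) {v₀ : E3 → E3}
    {u : ℝ → E3 → E3} {p : ℝ → E3 → ℝ} (h : IsLocalSolution ν T v₀ u p) :
    HasDerivWithinAt (fun s => enstrophy (u s))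
      (2 * (stretchI v₀ - ν * ∫ x, frobeniusNormSq (fderiv ℝ (curl v₀) x))) (Icc 0 (T / 2)) 0 := by
  have hT''0 : 0 < T / 2 := by linarith
  have hT''T : T / 2 < T := by linarith
  have hsol := isSolutionOn_of_isLocalSolution h hT''0 hT''T
  have htI : (0 : ℝ) ∈ Icc 0 (T / 2) := ⟨le_rfl, hT''0.le⟩
  have hW := hasDerivWithinAt_enstrophy hν hT h htI
  have hS : IsClassicalNSSolutionOn (Icc 0 (T / 2)) ν 0 u p := hsol.isClassical
  have hB : HasBoundedSobolevNormsOn (Icc 0 (T / 2)) u := hsol.sobolev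
  have hsm : ContDiff ℝ ∞ (u 0) := hS.contDiff_velocity htI
  obtain ⟨B₀, hB₀⟩ := linfty_bound_of_hasBoundedSobolevNormsOn_holds
    (fun s hs => (hS.contDiff_velocity hs).of_le (by norm_cast)) hB
  obtain ⟨B₁, -, hB₁⟩ := exists_forall_norm_fderiv_le_of_hasBoundedSobolevNormsOn
    (fun s hs => (hS.contDiff_velocity hs).of_le (by norm_cast)) hB
  have hfin : ∀ n : ℕ, ∫⁻ x, ‖iteratedFDeriv ℝ n (u 0) x‖ₑ ^ 2 < ⊤ := fun n => by
    obtain ⟨C, hC⟩ := hB n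
    exact (hC 0 htI).trans_lt ENNReal.coe_lt_top
  have h1 : stretchPerp (u 0) = stretchI (u 0) := by
    rw [stretchPerp_eq, ← integral_stretching_eq_stretch hsm (hS.divFree 0 htI) (hB₀ 0 htI) (hB₁ 0 htI)
      (hfin 1) (hfin 2)]
    rfl
  have h2 : dissip (u 0) = -∫ x, frobeniusNormSq (fderiv ℝ (curl (u 0)) x) :=
    dissip_eq_neg_integral_frobeniusNormSq hsm (hfin 1) (hfin 2) (hfin 3)
  refine hW.congr_deriv ?_
  rw [h1, h2, h.initial]
  ring

/-- `∫|∇curl (A•v)|²_F = A² ∫|∇curl v|²_F`. [folklore] -/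
theorem frobPalin_smul (A : ℝ) (v : E3 → E3) :
    ∫ x, frobeniusNormSq (fderiv ℝ (curl (A • v)) x) = A ^ 2 * ∫ x, frobeniusNormSq (fderiv ℝ (curl v) x) := by
  rw [← integral_const_mul]
  congr 1; funext x
  rw [curl_smul_fun, show (fun y => A • curl v y) = A • curl v from rfl, fderiv_const_smul_field,
    Pi.smul_apply,
    Summit.NavierStokesRegularity.NavierStokesRegularity.Theorems.Atarka2026.frobeniusNormSq_smul]

/-- The Chae/BKM local solution from the amplified two-blob datum `A • U` is a `SlabSol` on `[0, T/2)`
(smooth, divergence-free, compactly supported datum; finite energy from the `n = 0` Sobolev bound).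
[folklore] -/
theorem slabSol_smul_U {ν T A : ℝ} {u : ℝ → E3 → E3} {p : ℝ → E3 → ℝ} (hν : 0 < ν) (hT : 0 < T)
    (h : IsLocalSolution ν T (A • U) u p) : SlabSol ν (T / 2) (A • U) u p := by
  have hsm : ContDiff ℝ ∞ (A • U) := by
    rw [show (A • U) = fun x => A • U x from rfl]; exact U_contDiff.const_smul A
  have hdec : HasRapidSpatialDecay (A • U) := by
    rw [show (A • U) = fun x => A • U x from rfl]
    exact Literature.Claims.NS.ClayVariants.hasRapidSpatialDecay_const_smul U_contDiff
      (HasRapidSpatialDecay.of_hasCompactSupport U_contDiff U_hasCompactSupport) A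
  have hdiv : NSWave0.IsDivFree (A • U) := (isDatum_smul isOuroDatum_U.1 A).2.1
  obtain ⟨C, hC⟩ := h.sobolev (T / 2) (by linarith) 0
  refine ⟨hν, hsm, hdiv, hdec, h.isClassical.mono (Ico_subset_Ico_right (by linarith))
    (uniqueDiffOn_Ico 0 (T / 2)), h.initial, ⟨C, ENNReal.coe_lt_top, fun t ht => ?_⟩⟩
  calc ∫⁻ x, ‖u t x‖ₑ ^ 2 = ∫⁻ x, ‖iteratedFDeriv ℝ 0 (u t) x‖ₑ ^ 2 := by
        refine lintegral_congr fun x => ?_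
        rw [← ofReal_norm, ← ofReal_norm (iteratedFDeriv ℝ 0 (u t) x), norm_iteratedFDeriv_zero]
    _ ≤ C := hC t (Ico_subset_Icc_self ht)

/-- `En₀ (A • v) = A² En₀ v`. [folklore] -/
theorem En₀_smul (A : ℝ) (v : E3 → E3) : En₀ (A • v) = A ^ 2 * En₀ v := by
  unfold En₀
  rw [show (A • v) = fun x => A • v x from rfl]
  simp_rw [norm_smul, mul_pow, integral_const_mul, Real.norm_eq_abs, sq_abs]
  ring

/-- `(M⁶ E)^{1/6} = M E^{1/6}` (`M, E ≥ 0`). [folklore] -/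
theorem rpow_sixth_mul_pow_six {M E : ℝ} (hM : 0 ≤ M) (hE : 0 ≤ E) :
    (M ^ 6 * E) ^ ((1 : ℝ) / 6) = M * E ^ ((1 : ℝ) / 6) := by
  rw [Real.mul_rpow (by positivity) hE]
  congr 1
  rw [show (M ^ 6 : ℝ) = M ^ (6 : ℝ) by norm_cast, ← Real.rpow_mul hM]
  norm_num

/-- `gradsqF f ≥ 0`. [folklore] -/
theorem gradsqF_nonneg (f : E3 → E3) : 0 ≤ gradsqF f :=
  integral_nonneg fun x => Finset.sum_nonneg fun j _ => by positivity

/-- `En₀ v ≥ 0`. [folklore] -/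
theorem En₀_nonneg (v : E3 → E3) : 0 ≤ En₀ v := by
  unfold En₀
  have : 0 ≤ ∫ x, ‖v x‖ ^ 2 := integral_nonneg fun x => by positivity
  linarith

end Combine

open Combine

/-- **`¬ Step32_Combine K` (p.3 l.143–147 «Combining: dS/dt ≤ …»)**, every `K`, binder 1 of
`claim_of_steps`. [cite: PereiraSilva2025, p.3 l.143–147] -/
theorem not_Step32_Combine (K : Consts) : ¬ Step32_Combine K := by
  intro h
  -- constants of the datum `U`
  have hc₀ : 0 < K.CG ^ 2 * K.CG' := by
    have h1 : 0 < K.CG' := by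
      unfold Consts.CG'
      exact mul_pos (mul_pos K.CG_pos (by positivity)) (Real.rpow_pos_of_pos K.C_pos _)
    exact mul_pos (pow_pos K.CG_pos 2) h1
  set c₀ : ℝ := K.CG ^ 2 * K.CG' with hc₀def
  set σ : ℝ := stretchI U with hσdef
  have hσ : 0 < σ := stretchI_U_pos
  set PF : ℝ := ∫ x, frobeniusNormSq (fderiv ℝ (curl U) x) with hPFdef
  have hPF : 0 ≤ PF := integral_nonneg fun x => by simp only [frobeniusNormSq]; positivity
  set S : ℝ := enstrophy U with hSdef
  have hS0 : 0 ≤ S := integral_nonneg fun x => by positivity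
  set eU : ℝ := En₀ U ^ ((1 : ℝ) / 6) with heUdef
  have heU : 0 ≤ eU := Real.rpow_nonneg (En₀_nonneg U) _
  -- the amplitude and the viscosity
  set Q : ℝ := (1 / 3) * c₀ * eU * (PF + S) + PF with hQdef
  have hQ : 0 ≤ Q := by positivity
  set M : ℝ := Q / σ + 1 with hMdef
  have hM1 : 1 ≤ M := by
    have : 0 ≤ Q / σ := by positivity
    linarith
  have hM : 0 < M := by linarith
  set A : ℝ := M ^ 3 with hAdef
  have hA : 0 < A := by positivity
  set ν : ℝ := (1 / 3) * c₀ * M * eU + 1 with hνdef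
  have hν : 0 < ν := by positivity
  -- the datum `A • U` and its local solution
  have hD : IsOuroDatum (A • U) := isOuroDatum_smul isOuroDatum_U hA.ne'
  obtain ⟨T, hT, u, p, hsol⟩ := exists_isLocalSolution hν.le hD.1
  have hSl : SlabSol ν (T / 2) (A • U) u p := slabSol_smul_U hν hT hsol
  -- values on the datum
  have hE0 : En₀ (u 0) ^ ((1 : ℝ) / 6) = M * eU := by
    rw [hsol.initial, En₀_smul, hAdef, ← pow_mul, show (3 * 2 : ℕ) = 6 by rfl,
      rpow_sixth_mul_pow_six hM.le (En₀_nonneg U)]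
  have hens0 : enstrophy (u 0) = A ^ 2 * S := by
    rw [hsol.initial]; exact ens_smul A U
  set a : ℝ := (2 / 3) * c₀ * (M * eU) with hadef
  have ha : 0 ≤ a := by positivity
  -- «Combining» at interior times: S' ≤ a S
  have hEns : Ens u = fun s => enstrophy (u s) := by
    funext s; unfold Ens enstrophy; rfl
  have hle : ∀ t ∈ Ioo 0 (T / 2), 2 * (stretchPerp (u t) + ν * dissip (u t)) ≤ a * enstrophy (u t) := by
    intro t ht
    have hAt : HasDerivAt (Ens u) (2 * (stretchPerp (u t) + ν * dissip (u t))) t := by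
      rw [hEns]
      exact (hasDerivWithinAt_enstrophy hν hT hsol ⟨ht.1.le, ht.2.le⟩).hasDerivAt
        (Icc_mem_nhds ht.1 ht.2)
    have key := h ν (T / 2) (A • U) u p hSl t ht _ hAt
    rw [hE0] at key
    have hG : 0 ≤ G u t := gradsqF_nonneg _
    have hb : (1 / 3) * K.CG ^ 2 * K.CG' * (M * eU) - ν = -1 := by rw [hνdef, hc₀def]; ring
    rw [hb] at key
    have : (2 / 3) * K.CG ^ 2 * K.CG' * (M * eU) * Ens u t = a * enstrophy (u t) := by
      rw [hadef, hc₀def]; unfold Ens enstrophy; ring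
    linarith
  -- `g s = e^{-a s} S(s)` is antitone on `[0, T/2]`
  set g : ℝ → ℝ := fun s => Real.exp (-a * s) * enstrophy (u s) with hgdef
  have hcont : ContinuousOn (fun s => enstrophy (u s)) (Icc 0 (T / 2)) := fun t ht =>
    (hasDerivWithinAt_enstrophy hν hT hsol ht).continuousWithinAt
  have hexp : ∀ t : ℝ, HasDerivAt (fun s => Real.exp (-a * s)) (Real.exp (-a * t) * -a) t := fun t => by
    have := ((hasDerivAt_id t).const_mul (-a)).exp
    simpa using this
  have hanti : AntitoneOn g (Icc 0 (T / 2)) := by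
    refine antitoneOn_of_hasDerivWithinAt_nonpos (convex_Icc 0 (T / 2))
      (f' := fun t => Real.exp (-a * t) * -a * enstrophy (u t) +
        Real.exp (-a * t) * (2 * (stretchPerp (u t) + ν * dissip (u t)))) ?_ ?_ ?_
    · exact (Real.continuous_exp.comp (continuous_const.mul continuous_id)).continuousOn.mul hcont
    · intro t ht
      rw [interior_Icc] at ht
      have hAt : HasDerivAt (fun s => enstrophy (u s)) (2 * (stretchPerp (u t) + ν * dissip (u t))) t :=
        (hasDerivWithinAt_enstrophy hν hT hsol ⟨ht.1.le, ht.2.le⟩).hasDerivAt (Icc_mem_nhds ht.1 ht.2)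
      exact ((hexp t).mul hAt).hasDerivWithinAt
    · intro t ht
      rw [interior_Icc] at ht
      have h1 := hle t ht
      have h2 : 0 < Real.exp (-a * t) := Real.exp_pos _
      have : Real.exp (-a * t) * -a * enstrophy (u t) +
          Real.exp (-a * t) * (2 * (stretchPerp (u t) + ν * dissip (u t))) =
          Real.exp (-a * t) * (2 * (stretchPerp (u t) + ν * dissip (u t)) - a * enstrophy (u t)) := by
        ring
      rw [this]
      exact mul_nonpos_of_nonneg_of_nonpos h2.le (by linarith)
  -- but the right-derivative of `g` at `0` is positive
  have h0 := hasDerivWithinAt_enstrophy_zero hν hT hsol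
  rw [stretchI_smul, frobPalin_smul] at h0
  have hg0 : HasDerivWithinAt g (Real.exp (-a * 0) * -a * enstrophy (u 0) +
      Real.exp (-a * 0) * (2 * (A ^ 3 * σ - ν * (A ^ 2 * PF)))) (Icc 0 (T / 2)) 0 :=
    (hexp 0).hasDerivWithinAt.mul h0
  rw [hens0, mul_zero, Real.exp_zero, one_mul, one_mul] at hg0
  have hpos : 0 < -a * (A ^ 2 * S) + 2 * (A ^ 3 * σ - ν * (A ^ 2 * PF)) := by
    -- ÷ A² = M⁶: need 2(M³σ − νPF) > a S, i.e. M³σ > νPF + (1/3)c₀ M eU S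
    have hMσ : M * σ = Q + σ := by
      rw [hMdef]; field_simp
    have h1 : PF ≤ M * PF := le_mul_of_one_le_left hPF hM1
    have h2 : ν * PF + (1 / 3) * c₀ * (M * eU) * S = M * ((1 / 3) * c₀ * eU * (PF + S)) + PF := by
      rw [hνdef]; ring
    have h3 : M * Q = M * ((1 / 3) * c₀ * eU * (PF + S)) + M * PF := by rw [hQdef]; ring
    have h4 : M * Q = M ^ 2 * σ - M * σ := by
      rw [show Q = M * σ - σ by linarith]; ring
    have h5 : σ ≤ M * σ := le_mul_of_one_le_left hσ.le hM1
    have h6 : M ^ 2 * σ ≤ M ^ 3 * σ :=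
      mul_le_mul_of_nonneg_right (pow_le_pow_right₀ hM1 (by norm_num)) hσ.le
    have hkey : ν * PF + (1 / 3) * c₀ * (M * eU) * S < M ^ 3 * σ := by linarith
    have e2 : -a * (A ^ 2 * S) + 2 * (A ^ 3 * σ - ν * (A ^ 2 * PF)) =
        2 * A ^ 2 * (M ^ 3 * σ - (ν * PF + (1 / 3) * c₀ * (M * eU) * S)) := by
      rw [hadef, hAdef]; ring
    rw [e2]
    have : 0 < M ^ 3 * σ - (ν * PF + (1 / 3) * c₀ * (M * eU) * S) := by linarith
    positivity
  obtain ⟨t, ht, hlt⟩ := exists_gt_of_hasDerivWithinAt_pos (by linarith : (0 : ℝ) < T / 2) hg0 hpos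
  have := hanti ⟨le_rfl, by linarith⟩ ⟨ht.1.le, ht.2⟩ ht.1.le
  exact absurd this (not_le.2 hlt)

/-! ## FQN guard -/

example (K : Literature.Claims.NS.PereiraSilva2025.Consts) :
    ¬ Literature.Claims.NS.PereiraSilva2025.Step32_Combine K := not_Step32_Combine K

/-- info: 'Summit.NavierStokesRegularity.NavierStokesRegularity.Theorems.PereiraSilva2025.not_Step32_Combine' depends on axioms: [propext,
 Classical.choice,
 Quot.sound] -/
#guard_msgs in
#print axioms Summit.NavierStokesRegularity.NavierStokesRegularity.Theorems.PereiraSilva2025.not_Step32_Combine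

end Summit.NavierStokesRegularity.NavierStokesRegularity.Theorems.PereiraSilva2025

end
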